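import Literature.NumberTheory.Transcendental.ZilberFieldSaturationMain
import Literature.FieldTheory.Regular.RegularExtension
import HarnessLib

/-!
# The transported locus of a good basis is absolutely irreducible

Toolkit for Bays–Kirby 2018, Prop. 11.2 (`Literature.NumberTheory.Transcendental.BaysKirby2018_prop_11_2`; M. Bays, J. Kirby,
*Pseudo-exponential maps, variants, and quasiminimality*, Algebra & Number Theory 12 (2018),
Cor. 7.4, proof of Lemma 8.3, §11).

Let `θ : ⟨K c⟩ ≅ ⟨K c'⟩` be the field isomorphism of a Γ-isomorphism `c ↦ c'` over `K`
(`ZilberSaturationMain.bfld K c = K₀(allGens c)`), `b` a tuple, `P = I((b, exp b)/⟨K c⟩)`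
(`ZilberSaturationMain.locusIdeal`) and `P' = θ(P) ⊆ ⟨K c'⟩[X, Y]`
(`ZilberSaturationMain.locusIdeal'`). If `⟨K c⟩` is relatively algebraically closed in
`⟨K c⟩(b, exp b)` — the regularity supplied by
`GammaField.isAlgClosedIn_adjoinField_allGens_append` (`GammaFieldRegularity.lean`) once the
relative algebraic closure has been absorbed into `c` — then the extension `P'·F[X, Y]` of `P'`
to the big algebraically closed field is **prime**
(`GammaField.isPrime_map_locusIdeal'`): `Z(P')_F` is absolutely irreducible, i.e. it is its own
unique component. This is what makes `Z(P')_F` *defined over* the finitely generated field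
`K(c'/M!, exp (c'/M!))` in the application of generic strong Γ-closedness (Def. 11.1), which an
arbitrary component of a base change need not be. The proof presents `P'` as the ideal of the
point `(b, exp b)` over `⟨K c'⟩` for the *twisted* `⟨K c'⟩`-algebra structure
`⟨K c'⟩ →θ⁻¹ ⟨K c⟩ ⊆ ⟨K c⟩(b, exp b)` and applies
`Literature.FieldTheory.Regular.isPrime_map_ker_aeval` (Lang, *Algebra* VIII §4).

## References

* M. Bays, J. Kirby, *Pseudo-exponential maps, variants, and quasiminimality*, Algebra & Number
  Theory 12 (2018) 493–549: Cor. 7.4, Lemma 8.3 (proof), Def. 11.1, Prop. 11.2.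
* S. Lang, *Algebra*, GTM 211, VIII §4.
-/

noncomputable section

open Set MvPolynomial

universe u

namespace Literature.NumberTheory.Transcendental

namespace GammaField

open Literature.ModelTheory.ExponentialFields.ExponentialRing ZilberSaturationMain
  Literature.FieldTheory.Regular

variable {F : Type u} [Field F] [CharZero F] [Literature.ModelTheory.ExponentialFields.ExponentialRing F]
variable {K : Submodule ℚ F} {N n : ℕ}

/-- Membership in `P' = θ(P)`: `f' ∈ P'` iff `θ⁻¹ f'` vanishes at `(b, exp b)`. [folklore] -/
theorem mem_locusIdeal'_iff {c c' : Fin N → F} (hiso : IsGammaIso K c c') (b : Fin n → F)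
    (f' : MvPolynomial (Fin n ⊕ Fin n) (bfld K c')) :
    f' ∈ locusIdeal' K hiso b ↔
      aeval (gammaPt b) (MvPolynomial.map (hiso.fieldEquiv.symm : bfld K c' →+* bfld K c) f') = 0 := by
  rw [locusIdeal', LocusComponents.idealMapCoeff, Ideal.mem_map_of_equiv]
  constructor
  · rintro ⟨f, hf, rfl⟩
    have : MvPolynomial.map (hiso.fieldEquiv.symm : bfld K c' →+* bfld K c)
        (MvPolynomial.mapEquiv (Fin n ⊕ Fin n) hiso.fieldEquiv f) = f := by
      change MvPolynomial.map _ (MvPolynomial.map (hiso.fieldEquiv : bfld K c →+* bfld K c') f) = f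
      rw [MvPolynomial.map_map, RingEquiv.symm_comp, MvPolynomial.map_id]
    rw [this]
    exact (isGenericPt_locusIdeal K c b f).2 hf
  · intro hf
    refine ⟨MvPolynomial.map (hiso.fieldEquiv.symm : bfld K c' →+* bfld K c) f',
      (isGenericPt_locusIdeal K c b _).1 hf, ?_⟩
    change MvPolynomial.map (hiso.fieldEquiv : bfld K c →+* bfld K c') (MvPolynomial.map _ f') = f'
    rw [MvPolynomial.map_map, RingEquiv.comp_symm, MvPolynomial.map_id]

/-- **`P'·F[X, Y]` is prime** when `⟨K c⟩` is relatively algebraically closed in `⟨K c⟩(b, exp b)`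
(absolute irreducibility of the transported locus of a good basis over a regular base).
[cite: BaysKirby2018ANT, Cor. 7.4, Lemma 8.3 (proof)] -/
theorem isPrime_map_locusIdeal' {c c' : Fin N → F} (hiso : IsGammaIso K c c') (b : Fin n → F)
    (hrac : ∀ z ∈ IntermediateField.adjoin (fieldOf K) (allGens c ∪ range (gammaPt b)),
      IsAlgebraic (bfld K c) z → z ∈ bfld K c) :
    ((locusIdeal' K hiso b).map (MvPolynomial.map (algebraMap (bfld K c') F))).IsPrime := by
  classical
  -- the twisted algebra structure `⟨K c'⟩ →θ⁻¹ ⟨K c⟩ ⊆ Kr = ⟨K c⟩(b, exp b)`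
  let Kr := IntermediateField.adjoin (bfld K c) (range (gammaPt b))
  let φ : bfld K c' →+* Kr := (algebraMap (bfld K c) Kr).comp (hiso.fieldEquiv.symm : bfld K c' →+* bfld K c)
  letI algKr : Algebra (bfld K c') Kr := φ.toAlgebra
  have halg : (algebraMap (bfld K c') Kr) = φ := rfl
  let β : Fin n ⊕ Fin n → Kr := fun j => ⟨gammaPt b j, IntermediateField.subset_adjoin _ _ ⟨j, rfl⟩⟩
  have hβ : ∀ j, ((β j : Kr) : F) = gammaPt b j := fun _ => rfl
  -- membership in `Kr` is membership in the flat field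
  have hmemKr : ∀ z : F, z ∈ Kr ↔ z ∈ IntermediateField.adjoin (fieldOf K) (allGens c ∪ range (gammaPt b)) := by
    intro z
    rw [← IntermediateField.mem_restrictScalars (fieldOf K), IntermediateField.adjoin_adjoin_left]
  have hcompφ : (algebraMap Kr F).comp φ =
      (algebraMap (bfld K c) F).comp (hiso.fieldEquiv.symm : bfld K c' →+* bfld K c) := by
    refine RingHom.ext fun w => ?_
    simp only [φ, RingHom.coe_comp, Function.comp_apply]
    rw [IntermediateField.algebraMap_apply, IntermediateField.coe_algebraMap_apply]
  -- `⟨K c'⟩` is relatively algebraically closed in `Kr` for the twisted structure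
  have hrac' : ∀ z : Kr, IsAlgebraic (bfld K c') z → z ∈ range (algebraMap (bfld K c') Kr) := by
    intro z hz
    obtain ⟨p', hp'0, hp'⟩ := hz
    -- transport the algebraic relation along `θ`
    have halgc : IsAlgebraic (bfld K c) (z : F) := by
      refine ⟨p'.map (hiso.fieldEquiv.symm : bfld K c' →+* bfld K c), ?_, ?_⟩
      · exact (Polynomial.map_ne_zero_iff (hiso.fieldEquiv.symm).injective).2 hp'0
      · have h1 : (algebraMap Kr F) (Polynomial.aeval z p') = 0 := by rw [hp', map_zero]
        rw [Polynomial.aeval_def, Polynomial.hom_eval₂, halg, hcompφ] at h1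
        rw [Polynomial.aeval_def, Polynomial.eval₂_map]
        exact h1
    have hzc : (z : F) ∈ bfld K c := hrac _ ((hmemKr z).1 z.2) halgc
    refine ⟨hiso.fieldEquiv ⟨z, hzc⟩, Subtype.ext ?_⟩
    rw [halg]
    simp only [φ, RingHom.coe_comp, Function.comp_apply]
    rw [show (hiso.fieldEquiv.symm : bfld K c' →+* bfld K c) (hiso.fieldEquiv ⟨z, hzc⟩) = ⟨z, hzc⟩ from
      hiso.fieldEquiv.symm_apply_apply _, IntermediateField.coe_algebraMap_apply,
      IntermediateField.algebraMap_apply]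
  -- `P'` is the ideal of the point `β` for the twisted structure
  have hP : RingHom.ker (aeval β : MvPolynomial (Fin n ⊕ Fin n) (bfld K c') →ₐ[bfld K c'] Kr) =
      locusIdeal' K hiso b := by
    ext f'
    rw [RingHom.mem_ker, mem_locusIdeal'_iff]
    have h1 : (algebraMap Kr F) (aeval β f') =
        aeval (gammaPt b) (MvPolynomial.map (hiso.fieldEquiv.symm : bfld K c' →+* bfld K c) f') := by
      rw [aeval_def, eval₂_comp_left, halg, hcompφ, aeval_def, eval₂_map]
      congr 1
    constructor
    · intro h0
      rw [← h1, show aeval β f' = 0 from h0, map_zero]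
    · intro h0
      rw [← h1] at h0
      exact (injective_iff_map_eq_zero (algebraMap Kr F)).1 (algebraMap Kr F).injective _ h0
  rw [← hP]
  exact isPrime_map_ker_aeval (algebraMap (bfld K c') F) β hrac'

end GammaField

end Literature.NumberTheory.Transcendental
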